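import Literature.Computability.Cryptography.PeriodFindingBlocks
import HarnessLib

/-!
# The autocorrelation mass of a shift-cell table (exact factorisation)

Topic `Computability/Cryptography` (harmonic analysis of period finding); theorem-only file, no named facts.

A **shift-cell table** on `[0, W·S·a)` is a table of the form
`F (E + W j) = C_{cls E} ((σ E + j) mod S)` (`E < W`, `j < S a`): the low block `E` carries a *class*
`cls E` and a *shift* `σ E`, the high block `j` is read, modulo `S`, through a *cell function* `C_g` of the class,
and different classes have disjoint values. This is the shape of the table of Hallgren's class-group algorithm
once the distance coordinate is laid on an exactly periodic grid (`E` = exponent vector of the prime-ideal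
generators, `cls E` = ideal class, `σ E` = grid position of the product ideal on the cycle of its class,
`C_g` = the cycle of class `g` cut into cells) [Hallgren2005, §4].

* `corrMass_shiftCell` — **the autocorrelation mass factorises exactly**: at frequency `c` it vanishes unless
  `a ∣ c`, and for `c = a k`
  `corrMass (W S a) F c = a² ∑_g |∑_{E : cls E = g} chr_{WSa}(c E) chr_S(−k σ E)|² · corrMass S C_g k` —
  a one-dimensional autocorrelation mass of the cell function times a *twisted class sum* over the low block.
  All the multi-dimensional structure of the algorithm's output law is in the twisted class sums; all the
  cycle geometry is in the one-dimensional factor.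
* `sum_range_shift`, `chr_mul_mul`, `chr_natMod` — the reindexing and character bookkeeping used.

## References

* S. Hallgren, *Fast quantum algorithms for computing the unit group and class group of a number field*,
  STOC 2005, §4. [Hallgren2005]
* P. W. Shor, SIAM J. Comput. 26 (1997), §5. [Shor1997]
-/

noncomputable section

namespace Literature.Computability.Cryptography

namespace PeriodFinding

open Complex Finset

/-! ### Bookkeeping -/

/-- Summing a function of `(s + i) mod S` over `i < S` is summing it over `[0, S)`. [folklore] -/
theorem sum_range_shift {M : Type*} [AddCommMonoid M] {S : ℕ} (hS : 0 < S) (s : ℕ) (G : ℕ → M) :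
    ∑ i ∈ range S, G ((s + i) % S) = ∑ i ∈ range S, G i := by
  haveI : NeZero S := ⟨hS.ne'⟩
  rw [← Fin.sum_univ_eq_sum_range (fun i => G ((s + i) % S)), ← Fin.sum_univ_eq_sum_range G]
  have h : ∀ i : Fin S, G ((s + (i : ℕ)) % S) = G ((Fin.ofNat S s + i : Fin S) : ℕ) := by
    intro i
    congr 1
    rw [Fin.val_add, Fin.val_ofNat, Nat.mod_add_mod]
  simp_rw [h]
  exact Equiv.sum_comp (Equiv.addLeft (Fin.ofNat S s)) (fun i : Fin S => G i)

/-- `chr` is symmetric in frequency and argument. [folklore] -/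
theorem chr_comm (Q : ℕ) (c v : ℤ) : chr Q c v = chr Q v c := by
  unfold chr; ring_nf

/-- Scaling: `chr (W Q) c (W v) = chr Q c v`. [folklore] -/
theorem chr_mul_mul (W Q : ℕ) (hW : 0 < W) (hQ : 0 < Q) (c v : ℤ) :
    chr (W * Q) c ((W : ℤ) * v) = chr Q c v := by
  have hW' : (W : ℂ) ≠ 0 := by exact_mod_cast hW.ne'
  have hQ' : (Q : ℂ) ≠ 0 := by exact_mod_cast hQ.ne'
  unfold chr
  congr 1
  push_cast
  field_simp

/-- Scaling in the frequency: `chr (S a) (a k) v = chr S k v`. [folklore] -/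
theorem chr_mul_left (S a : ℕ) (hS : 0 < S) (ha : 0 < a) (k v : ℤ) :
    chr (S * a) ((a : ℤ) * k) v = chr S k v := by
  rw [chr_comm, mul_comm S a, chr_mul_mul a S ha hS, chr_comm]

/-- `chr S k` is trivial on multiples of `S`. [folklore] -/
theorem chr_mul_self_left (S : ℕ) (hS : 0 < S) (k t : ℤ) : chr S k ((S : ℤ) * t) = 1 := by
  unfold chr
  have hS' : (S : ℂ) ≠ 0 := by exact_mod_cast hS.ne'
  have : (2 * (Real.pi : ℂ) * I * ((k : ℂ) * (((S : ℤ) * t : ℤ) : ℂ) / (S : ℂ))) =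
      ((k * t : ℤ) : ℂ) * (2 * Real.pi * I) := by
    push_cast; field_simp
  rw [this]
  exact Complex.exp_int_mul_two_pi_mul_I _

/-- `chr S k` only depends on the argument modulo `S`. [folklore] -/
theorem chr_natMod (S : ℕ) (hS : 0 < S) (k : ℤ) (n : ℕ) : chr S k ((n % S : ℕ) : ℤ) = chr S k n := by
  have h : (n : ℤ) = ((n % S : ℕ) : ℤ) + (S : ℤ) * ((n / S : ℕ) : ℤ) := by
    norm_cast; rw [Nat.mod_add_div]
  rw [h, chr_add, chr_mul_self_left S hS, mul_one]

/-- `∑_{q < a} chr a c q = a · [a ∣ c]`. [folklore] -/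
theorem sum_chr_arg (a : ℕ) (ha : 0 < a) (c : ℤ) :
    ∑ q ∈ range a, chr a c q = if (a : ℤ) ∣ c then (a : ℂ) else 0 := by
  rw [← sum_chr a ha c]
  exact sum_congr rfl fun q _ => chr_comm _ _ _

variable {Ω : Type*} [DecidableEq Ω]

/-! ### The factorisation -/

/-- **The fibre sums of a shift-cell table.** For a class `g` and a value `ω` of its cell function, the character
sum over the fibre `{v < W S a : F v = ω}` is
`a[a ∣ c] · (∑_{i<S, C_g i = ω} chr_S(k i)) · ∑_{E<W, cls E = g} chr_{WSa}(c E) chr_S(−k σ E)`, `k = c / a`.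
[cite: Hallgren2005, §4] -/
theorem fibreSum_shiftCell (W S a : ℕ) (hW : 0 < W) (hS : 0 < S) (ha : 0 < a)
    (cls σ : ℕ → ℕ) (C : ℕ → ℕ → Ω)
    (hC : ∀ E < W, ∀ E' < W, ∀ i < S, ∀ i' < S, C (cls E) i = C (cls E') i' → cls E = cls E')
    (F : ℕ → Ω) (hF : ∀ E < W, ∀ j < S * a, F (E + W * j) = C (cls E) ((σ E + j) % S)) (c : ℤ)
    {g : ℕ} (hg : g ∈ (range W).image cls) {ω : Ω} (hω : ω ∈ (range S).image (C g)) :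
    ∑ v ∈ (range (W * (S * a))).filter (fun v => F v = ω), chr (W * (S * a)) c v =
      (if (a : ℤ) ∣ c then (a : ℂ) else 0) * (∑ i ∈ (range S).filter (fun i => C g i = ω), chr S (c / a) i) *
        ∑ E ∈ (range W).filter (fun E => cls E = g), chr (W * (S * a)) c E * chr S (c / a) (-(σ E : ℤ)) := by
  classical
  have hSa : 0 < S * a := Nat.mul_pos hS ha
  obtain ⟨E₀, hE₀W, hE₀g⟩ := mem_image.1 hg
  obtain ⟨i₀, hi₀S, hi₀ω⟩ := mem_image.1 hω
  simp only [sum_filter]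
  rw [sum_range_mul_blocks W (S * a), sum_comm, mul_sum]
  refine sum_congr rfl fun E hE => ?_
  have hEW : E < W := mem_range.1 hE
  by_cases hcls : cls E = g
  · rw [if_pos hcls]
    -- split the character and the high block `j = i + S q`
    have h1 : ∀ j ∈ range (S * a), (if F (E + W * j) = ω then chr (W * (S * a)) c ((E + W * j : ℕ) : ℤ) else 0) =
        chr (W * (S * a)) c E * (if C g ((σ E + j) % S) = ω then chr (S * a) c j else 0) := by
      intro j hj
      rw [hF E hEW j (mem_range.1 hj), hcls]
      split_ifs
      · push_cast
        rw [chr_add, chr_mul_mul W (S * a) hW hSa]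
      · rw [mul_zero]
    rw [sum_congr rfl h1, ← mul_sum, sum_range_mul_blocks S a]
    have h2 : ∀ q ∈ range a, ∀ i ∈ range S,
        (if C g ((σ E + (i + S * q)) % S) = ω then chr (S * a) c ((i + S * q : ℕ) : ℤ) else 0) =
          (if C g ((σ E + i) % S) = ω then chr (S * a) c i else 0) * chr a c q := by
      intro q _ i _
      rw [show σ E + (i + S * q) = σ E + i + S * q by ring, Nat.add_mul_mod_self_left]
      split_ifs
      · push_cast
        rw [chr_add, chr_mul_mul S a hS ha]
      · rw [zero_mul]
    rw [sum_congr rfl fun q hq => sum_congr rfl fun i hi => h2 q hq i hi]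
    simp_rw [← sum_mul]
    rw [← mul_sum, sum_chr_arg a ha c]
    split_ifs with hdvd
    · -- `c = a k`
      obtain ⟨k, hk⟩ := hdvd
      have hk' : c / a = k := by rw [hk, Int.mul_ediv_cancel_left _ (by exact_mod_cast ha.ne')]
      rw [hk']
      have h3 : ∀ i ∈ range S, (if C g ((σ E + i) % S) = ω then chr (S * a) c i else 0) =
          chr S k (-(σ E : ℤ)) * (if C g ((σ E + i) % S) = ω then chr S k (((σ E + i) % S : ℕ) : ℤ) else 0) := by
        intro i _
        split_ifs
        · rw [hk, chr_mul_left S a hS ha, chr_natMod S hS, Nat.cast_add, ← chr_add]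
          congr 1; ring
        · rw [mul_zero]
      rw [sum_congr rfl h3, ← mul_sum,
        sum_range_shift hS (σ E) (fun i => if C g i = ω then chr S k (i : ℤ) else 0)]
      ring
    · simp
  · rw [if_neg hcls, mul_zero]
    refine sum_eq_zero fun j hj => ?_
    rw [if_neg]
    rw [hF E hEW j (mem_range.1 hj)]
    intro h
    exact hcls ((hC E hEW E₀ (mem_range.1 hE₀W) _ (Nat.mod_lt _ hS) i₀ (mem_range.1 hi₀S)
      (h.trans (hE₀g.symm ▸ hi₀ω).symm)).trans hE₀g)

/-- **The autocorrelation mass of a shift-cell table factorises exactly.** With `F (E + W j) = C_{cls E}((σ E + j) mod S)`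
on `[0, W S a)` (classes with pairwise disjoint cell values): `corrMass (W S a) F c = 0` unless `a ∣ c`, and for
`c = a k`
`corrMass (W S a) F c = a² ∑_{g} |∑_{E<W, cls E = g} chr_{WSa}(c E) · chr_S(−k σ E)|² · corrMass S C_g k`.
So the output law of Fourier sampling such a table is a mixture over the classes `g`, weighted by the squared
twisted class sums, of the one-dimensional laws of the cell functions. [cite: Hallgren2005, §4] -/
theorem corrMass_shiftCell (W S a : ℕ) (hW : 0 < W) (hS : 0 < S) (ha : 0 < a)
    (cls σ : ℕ → ℕ) (C : ℕ → ℕ → Ω)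
    (hC : ∀ E < W, ∀ E' < W, ∀ i < S, ∀ i' < S, C (cls E) i = C (cls E') i' → cls E = cls E')
    (F : ℕ → Ω) (hF : ∀ E < W, ∀ j < S * a, F (E + W * j) = C (cls E) ((σ E + j) % S)) (c : ℤ) :
    corrMass (W * (S * a)) F c =
      if (a : ℤ) ∣ c then
        (a : ℝ) ^ 2 * ∑ g ∈ (range W).image cls,
          ‖∑ E ∈ (range W).filter (fun E => cls E = g), chr (W * (S * a)) c E * chr S (c / a) (-(σ E : ℤ))‖ ^ 2 *
            corrMass S (C g) (c / a)
      else 0 := by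
  classical
  have hSa : 0 < S * a := Nat.mul_pos hS ha
  -- the values of `F` are among the cell values of the classes met in the low block
  have hsub : (range (W * (S * a))).image F ⊆ ((range W).image cls).biUnion fun g => (range S).image (C g) := by
    intro ω hω
    obtain ⟨v, hv, rfl⟩ := mem_image.1 hω
    have hvQ : v < W * (S * a) := mem_range.1 hv
    have hEW : v % W < W := Nat.mod_lt _ hW
    have hj : v / W < S * a := Nat.div_lt_of_lt_mul hvQ
    rw [← Nat.mod_add_div v W, hF _ hEW _ hj]
    exact mem_biUnion.2 ⟨cls (v % W), mem_image_of_mem _ (mem_range.2 hEW),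
      mem_image_of_mem _ (mem_range.2 (Nat.mod_lt _ hS))⟩
  have hdisj : Set.PairwiseDisjoint (↑((range W).image cls)) fun g => (range S).image (C g) := by
    intro g hg g' hg' hne
    obtain ⟨E, hE, rfl⟩ := mem_image.1 (mem_coe.1 hg)
    obtain ⟨E', hE', rfl⟩ := mem_image.1 (mem_coe.1 hg')
    refine disjoint_left.2 fun ω hω hω' => hne ?_
    obtain ⟨i, hi, rfl⟩ := mem_image.1 hω
    obtain ⟨i', hi', h⟩ := mem_image.1 hω'
    exact hC E (mem_range.1 hE) E' (mem_range.1 hE') i (mem_range.1 hi) i' (mem_range.1 hi') h.symm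
  have hzero : ∀ ω ∈ ((range W).image cls).biUnion (fun g => (range S).image (C g)),
      ω ∉ (range (W * (S * a))).image F →
      ‖∑ v ∈ (range (W * (S * a))).filter (fun v => F v = ω), chr (W * (S * a)) c v‖ ^ 2 = 0 := by
    intro ω _ hω
    have : (range (W * (S * a))).filter (fun v => F v = ω) = ∅ :=
      filter_eq_empty_iff.2 fun v hv h => hω (mem_image.2 ⟨v, hv, h⟩)
    rw [this, sum_empty, norm_zero, zero_pow two_ne_zero]
  unfold corrMass
  rw [sum_subset hsub hzero, sum_biUnion hdisj]
  split_ifs with hdvd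
  · rw [mul_sum]
    refine sum_congr rfl fun g hg => ?_
    rw [mul_sum, mul_sum]
    refine sum_congr rfl fun ω hω => ?_
    rw [fibreSum_shiftCell W S a hW hS ha cls σ C hC F hF c hg hω, if_pos hdvd, norm_mul, norm_mul, mul_pow, mul_pow,
      Complex.norm_natCast]
    ring
  · refine sum_eq_zero fun g hg => sum_eq_zero fun ω hω => ?_
    rw [fibreSum_shiftCell W S a hW hS ha cls σ C hC F hF c hg hω, if_neg hdvd, zero_mul, zero_mul, norm_zero,
      zero_pow two_ne_zero]

end PeriodFinding

end Literature.Computability.Cryptography
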